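import Literature.MathematicalPhysics.QuantumLattice.Imbrie2016.WeylWindow

/-!
# Imbrie (2016), Assumption LLA: the second-order window frees blocks up to sνϰN ≤ 40 — the bookkeeping half,
kernel-checked; the window theorem itself enters as a NAMED HYPOTHESIS

CITATION HEADER (lean-in-tree rule 2026-08-18). J. Z. Imbrie, *On many-body localization for quantum spin chains*,
J. Stat. Phys. **163** (2016) 998–1048, doi 10.1007/s10955-016-1508-x, arXiv:1403.7837 [ImbrieJSP2016]: eq. (1.1) (model),
p. 1000 (admissible laws), eq. (1.3) = (5.2) (Assumption LLA(ν, C)), §5 proof of Thm 5.1 (the consumed instance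
"P(min_{α≠β}|E_α − E_β| < ε^{sϰn}) ≤ ε^{sνϰn} for a block of n sites in a box of ≤ mn sites", ε = γ^{1/20}).
WHAT IS PROVED (lemmas of the audit cell `pub-imbrie`, LLA.md addendum WG8 (a) / REPAIR-CENSUS S1-V197 — NOT statements of
the paper, which assumes LLA and proves nothing about it):
  * `SecondOrderWindowBound L ρ₀` (a `Prop`, used only as a HYPOTHESIS): the cell's THEOREM WG (LLA.md WG1–WG2: for every
    coupling γ ≥ 0, box of n sites and δ, P_γ(∃ α ≠ β : |E_α − E_β| < δ) ≤ 8ⁿ ρ₀ (δ + 32 ρ₀ (γn)²) — Weyl localisation,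
    two independent field conditions for non-isolated resonant pairs, exact 2 × 2 Feshbach reduction and a one-site Wegner
    estimate for isolated ones). WG is proved ON PAPER in the cell with a kernel-checked skeleton
    (`Imbrie2016/SecondOrderWindow.lean`); its in-model matrix analysis is NOT kernel-checked, so here it is an assumption.
  * `eventually_secondOrderWindow_le_consumedBound` (unconditional, real-variable): for ν < 1, s, ϰ > 0, n ≥ 1 with
    sνϰn < 40 and any n′, eventually as γ → 0⁺:  8^{n′} ρ₀ (ε^{sϰn} + 32 ρ₀ (γ n′)²) ≤ ε^{sνϰn}, ε = γ^{1/20}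
    (the threshold term is beaten because ν < 1, the second-order term because γ² = ε^{40} and sνϰn < 40).
  * `target_lt_secondOrderTerm_of_gt` (unconditional): conversely, for sνϰn > 40, ρ₀ > 0 and n′ ≥ 1 the second-order
    term alone eventually EXCEEDS the target — a window theorem with floor ∝ γ² frees exactly the blocks with sνϰn < 40.
  * `smallBlocks_consumedA2_of_secondOrderWindow` (**conditional on WG**): if `SecondOrderWindowBound L ρ₀` then for
    0 < ν < 1, s, ϰ > 0, m and N with sνϰN ≤ 40 there is γ₀ > 0 such that for all γ ∈ (0, γ₀], all blocks of n < N sites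
    (n ≥ 1) and boxes of n′ ∈ [n, mn] sites, P_γ(min gap < ε^{sϰn}) ≤ ε^{sνϰn} — the consumed instance of A2 holds for
    blocks below N = 40/(sνϰ), DOUBLING the unconditional range sνϰN ≤ 20 of `WeylWindow.smallBlocks_consumedA2`.
STATUS: the real-variable lemmas are unconditional theorems; the block statement is CONDITIONAL on WG (paper-proved, not
kernel-checked). None of this proves LLA or A2: every window theorem of order k covers only sνϰn < 20k at fixed γ (LLA.md
WG8 (b), the ceiling of the window ladder). LLA for γ > 0 remains the unproved hypothesis of [ImbrieJSP2016] Thm 1.1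
(cell verdict: OPEN). Unit b2b-imbrie-1-g13 (gen 13 of the LLA seat).
-/

noncomputable section
open _root_.MeasureTheory Filter Topology
open scoped ENNReal

namespace Literature.MathematicalPhysics.QuantumLattice.Imbrie2016

/-- THEOREM WG of the audit cell as a named hypothesis (paper-proved in LLA.md WG1–WG2, skeleton kernel-checked in
`SecondOrderWindow.lean`, in-model matrix analysis NOT kernel-checked): for laws `L` (with field/coupling densities
bounded by `ρ₀` and `|Γ_i| ≤ 1` a.s.), every coupling `γ ≥ 0`, box `[a, a + n − 1]` and `δ`,
`P_γ(∃ α ≠ β : |E_α − E_β| < δ) ≤ 8ⁿ ρ₀ (δ + 32 ρ₀ (γ n)²)`. [cite: ImbrieJSP2016, eq. (1.3); LLA.md WG1] -/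
def SecondOrderWindowBound (L : Laws) (ρ₀ : ℝ) : Prop :=
  ∀ (γ : ℝ) (a : ℤ) (n : ℕ) (δ : ℝ), 0 ≤ γ →
    L.boxMeasure a n {t | SmallGap γ δ (Params.ofTriple t)} ≤
      ENNReal.ofReal (8 ^ n * ρ₀ * (δ + 32 * ρ₀ * (γ * n) ^ 2))

/-- the real-variable heart of "the second-order window frees blocks up to 40": for ν < 1, s, ϰ > 0, n ≥ 1 with
sνϰn < 40 and any n′, eventually as γ → 0⁺, 8^{n′} ρ₀ (ε^{sϰn} + 32 ρ₀ (γ n′)²) ≤ ε^{sνϰn} with ε = γ^{1/20}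
(threshold term: ν < 1; second-order term: γ² = ε^{40} and sνϰn/20 < 2; any real ρ₀).
[cite: ImbrieJSP2016, §5 proof of Thm 5.1; LLA.md WG8 (a)] -/
theorem eventually_secondOrderWindow_le_consumedBound (ρ₀ : ℝ) {ν s ϰ : ℝ} (hν1 : ν < 1)
    (hs : 0 < s) (hϰ : 0 < ϰ) {n : ℕ} (hn : 0 < n) (hB : s * ν * ϰ * n < 40) (n' : ℕ) :
    ∀ᶠ γ : ℝ in 𝓝[>] 0,
      8 ^ n' * ρ₀ * ((γ ^ (1 / 20 : ℝ)) ^ (s * ϰ * n) + 32 * ρ₀ * (γ * n') ^ 2) ≤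
        (γ ^ (1 / 20 : ℝ)) ^ (s * ν * ϰ * n) := by
  set A : ℝ := 1 / 20 * (s * ϰ * n) with hA
  set B : ℝ := 1 / 20 * (s * ν * ϰ * n) with hBdef
  have hnR : (0 : ℝ) < n := by exact_mod_cast hn
  have hAB : 0 < A - B := by
    have e : A - B = 1 / 20 * (s * ϰ * n) * (1 - ν) := by rw [hA, hBdef]; ring
    rw [e]
    have : 0 < 1 - ν := by linarith
    positivity
  have hB2 : 0 < 2 - B := by
    have e : B = s * ν * ϰ * n / 20 := by rw [hBdef]; ring
    rw [e]; linarith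
  have ev1 : ∀ᶠ γ : ℝ in 𝓝[>] 0, 8 ^ n' * ρ₀ * γ ^ (A - B) ≤ 1 / 2 := by
    have h1 : Tendsto (fun γ : ℝ => 8 ^ n' * ρ₀ * γ ^ (A - B)) (𝓝 0)
        (𝓝 (8 ^ n' * ρ₀ * (0 : ℝ) ^ (A - B))) :=
      ((Real.continuousAt_rpow_const 0 (A - B) (Or.inr hAB.le)).tendsto).const_mul _
    rw [Real.zero_rpow hAB.ne', mul_zero] at h1
    exact (tendsto_nhdsWithin_of_tendsto_nhds h1).eventually_le_const (by norm_num)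
  have ev2 : ∀ᶠ γ : ℝ in 𝓝[>] 0, 32 * 8 ^ n' * ρ₀ ^ 2 * (n' : ℝ) ^ 2 * γ ^ (2 - B) ≤ 1 / 2 := by
    have h1 : Tendsto (fun γ : ℝ => 32 * 8 ^ n' * ρ₀ ^ 2 * (n' : ℝ) ^ 2 * γ ^ (2 - B)) (𝓝 0)
        (𝓝 (32 * 8 ^ n' * ρ₀ ^ 2 * (n' : ℝ) ^ 2 * (0 : ℝ) ^ (2 - B))) :=
      ((Real.continuousAt_rpow_const 0 (2 - B) (Or.inr hB2.le)).tendsto).const_mul _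
    rw [Real.zero_rpow hB2.ne', mul_zero] at h1
    exact (tendsto_nhdsWithin_of_tendsto_nhds h1).eventually_le_const (by norm_num)
  have ev0 : ∀ᶠ γ : ℝ in 𝓝[>] 0, 0 < γ := eventually_mem_nhdsWithin
  filter_upwards [ev0, ev1, ev2] with γ hγ h1 h2
  have hγB : 0 < γ ^ B := Real.rpow_pos_of_pos hγ B
  have eA : (γ ^ (1 / 20 : ℝ)) ^ (s * ϰ * n) = γ ^ B * γ ^ (A - B) := by
    rw [← Real.rpow_mul hγ.le, ← Real.rpow_add hγ, ← hA]
    congr 1; ring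
  have eB : (γ ^ (1 / 20 : ℝ)) ^ (s * ν * ϰ * n) = γ ^ B := by
    rw [← Real.rpow_mul hγ.le]
  have e2 : γ ^ B * γ ^ (2 - B) = γ ^ 2 := by
    rw [← Real.rpow_add hγ, add_sub_cancel]
    exact Real.rpow_two γ
  rw [eA, eB]
  calc 8 ^ n' * ρ₀ * (γ ^ B * γ ^ (A - B) + 32 * ρ₀ * (γ * n') ^ 2)
      = 8 ^ n' * ρ₀ * (γ ^ B * γ ^ (A - B) + 32 * ρ₀ * (γ ^ B * γ ^ (2 - B)) * (n' : ℝ) ^ 2) := by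
        rw [e2]; ring
    _ = γ ^ B * (8 ^ n' * ρ₀ * γ ^ (A - B) + 32 * 8 ^ n' * ρ₀ ^ 2 * (n' : ℝ) ^ 2 * γ ^ (2 - B)) := by ring
    _ ≤ γ ^ B * (1 / 2 + 1 / 2) := mul_le_mul_of_nonneg_left (add_le_add h1 h2) hγB.le
    _ = γ ^ B := by ring

/-- the range `sνϰn < 40` is what a floor `∝ γ²` frees and no more: for sνϰn > 40, ρ₀ > 0 and n′ ≥ 1 the second-order
term alone eventually exceeds the target, ε^{sνϰn} < 8^{n′} ρ₀ · 32 ρ₀ (γ n′)² as γ → 0⁺ (LLA.md WG8 (a),(b): an order-k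
window theorem frees exactly sνϰn < 20k). [cite: ImbrieJSP2016, §5 proof of Thm 5.1; LLA.md WG8 (b)] -/
theorem target_lt_secondOrderTerm_of_gt {ρ₀ ν s ϰ : ℝ} (hρ : 0 < ρ₀) {n : ℕ} (hB : 40 < s * ν * ϰ * n)
    {n' : ℕ} (hn' : 0 < n') :
    ∀ᶠ γ : ℝ in 𝓝[>] 0,
      (γ ^ (1 / 20 : ℝ)) ^ (s * ν * ϰ * n) < 8 ^ n' * ρ₀ * (32 * ρ₀ * (γ * n') ^ 2) := by
  set B : ℝ := 1 / 20 * (s * ν * ϰ * n) with hBdef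
  have hB2 : 0 < B - 2 := by
    have e : B = s * ν * ϰ * n / 20 := by rw [hBdef]; ring
    rw [e]; linarith
  set c : ℝ := 8 ^ n' * ρ₀ * (32 * ρ₀ * (n' : ℝ) ^ 2) with hc
  have hcpos : 0 < c := by
    have : (0 : ℝ) < n' := by exact_mod_cast hn'
    positivity
  have ev1 : ∀ᶠ γ : ℝ in 𝓝[>] 0, γ ^ (B - 2) < c := by
    have h1 : Tendsto (fun γ : ℝ => γ ^ (B - 2)) (𝓝 0) (𝓝 ((0 : ℝ) ^ (B - 2))) :=
      (Real.continuousAt_rpow_const 0 (B - 2) (Or.inr hB2.le)).tendsto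
    rw [Real.zero_rpow hB2.ne'] at h1
    exact (tendsto_nhdsWithin_of_tendsto_nhds h1).eventually_lt_const hcpos
  have ev0 : ∀ᶠ γ : ℝ in 𝓝[>] 0, 0 < γ := eventually_mem_nhdsWithin
  filter_upwards [ev0, ev1] with γ hγ h1
  have eB : (γ ^ (1 / 20 : ℝ)) ^ (s * ν * ϰ * n) = γ ^ (B - 2) * γ ^ 2 := by
    rw [← Real.rpow_mul hγ.le, ← Real.rpow_two, ← Real.rpow_add hγ, ← hBdef]
    congr 1; ring
  have hγ2 : 0 < γ ^ 2 := by positivity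
  rw [eB]
  calc γ ^ (B - 2) * γ ^ 2 < c * γ ^ 2 := mul_lt_mul_of_pos_right h1 hγ2
    _ = 8 ^ n' * ρ₀ * (32 * ρ₀ * (γ * n') ^ 2) := by rw [hc]; ring

/-- **The second-order window frees blocks up to 40 (conditional on WG)** (audit cell, LLA.md WG8 (a) / REPAIR-CENSUS
S1-V197, complementing `WeylWindow.smallBlocks_consumedA2` whose hypothesis is sνϰN ≤ 20): IF the laws satisfy the
second-order window bound `SecondOrderWindowBound L ρ₀` (the cell's paper-proved THEOREM WG), then for 0 < ν < 1, s, ϰ > 0,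
a collar multiple m and N with sνϰN ≤ 40 there is γ₀ > 0 such that for every γ ∈ (0, γ₀], every block of n sites with
1 ≤ n < N and every box of n′ ∈ [n, mn] sites the consumed instance P_γ(min gap < ε^{sϰn}) ≤ ε^{sνϰn} (ε = γ^{1/20})
holds. What Thm 1.1 would then still need as a hypothesis is the same bound for blocks of n ≥ 40/(sνϰ) sites.
[cite: ImbrieJSP2016, §5 proof of Thm 5.1; LLA.md WG8 (a)] -/
theorem smallBlocks_consumedA2_of_secondOrderWindow {L : Laws} {ρ₀ : ℝ} (hW : SecondOrderWindowBound L ρ₀)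
    {ν s ϰ : ℝ} (hν : 0 < ν) (hν1 : ν < 1) (hs : 0 < s) (hϰ : 0 < ϰ) (m N : ℕ) (hN : s * ν * ϰ * N ≤ 40) :
    ∃ γ₀ > 0, ∀ γ : ℝ, 0 < γ → γ ≤ γ₀ →
      ∀ (a : ℤ) (n n' : ℕ), 0 < n → n < N → n ≤ n' → n' ≤ m * n →
        L.boxMeasure a n' {t | SmallGap γ ((γ ^ (1 / 20 : ℝ)) ^ (s * ϰ * n)) (Params.ofTriple t)}
          ≤ ENNReal.ofReal ((γ ^ (1 / 20 : ℝ)) ^ (s * ν * ϰ * n)) := by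
  have hev : ∀ᶠ γ : ℝ in 𝓝[>] 0, ∀ n ∈ Finset.range N, ∀ n' ∈ Finset.range (m * N + 1), 0 < n →
      8 ^ n' * ρ₀ * ((γ ^ (1 / 20 : ℝ)) ^ (s * ϰ * n) + 32 * ρ₀ * (γ * n') ^ 2) ≤
        (γ ^ (1 / 20 : ℝ)) ^ (s * ν * ϰ * n) := by
    refine (Filter.eventually_all_finset _).mpr fun n hn =>
      (Filter.eventually_all_finset _).mpr fun n' _ => ?_
    rcases Nat.eq_zero_or_pos n with h0 | hpos
    · exact Filter.Eventually.of_forall fun γ h => absurd h (by omega)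
    · have hnN : n < N := Finset.mem_range.mp hn
      have hB : s * ν * ϰ * n < 40 := by
        have hnN' : (n : ℝ) < N := by exact_mod_cast hnN
        have : s * ν * ϰ * n < s * ν * ϰ * N := mul_lt_mul_of_pos_left hnN' (by positivity)
        linarith
      exact (eventually_secondOrderWindow_le_consumedBound ρ₀ hν1 hs hϰ hpos hB n').mono fun γ h _ => h
  obtain ⟨γ₀, hγ₀, hsub⟩ := mem_nhdsGT_iff_exists_Ioc_subset.mp hev
  refine ⟨γ₀, hγ₀, fun γ hγ hγle a n n' hn hnN hnn' hn'm => ?_⟩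
  have hn'r : n' ∈ Finset.range (m * N + 1) :=
    Finset.mem_range.mpr (Nat.lt_succ_of_le (hn'm.trans (Nat.mul_le_mul_left m hnN.le)))
  have hineq := hsub ⟨hγ, hγle⟩ n (Finset.mem_range.mpr hnN) n' hn'r hn
  exact (hW γ a n' _ hγ.le).trans (ENNReal.ofReal_le_ofReal hineq)

end Literature.MathematicalPhysics.QuantumLattice.Imbrie2016
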